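import Summits.BirchSwinnertonDyer.Rank1Residual.GaloisImage.TwoLagrangianLinesPairing
import Summits.BirchSwinnertonDyer.Rank1Residual.GaloisImage.UnramifiedClassesIsotropic
import Summits.BirchSwinnertonDyer.Rank1Residual.GaloisImage.LagrangianPlaneTwoLines
import Summits.BirchSwinnertonDyer.Rank1Residual.Additive.UnramifiedKummerDisjoint
import Summits.BirchSwinnertonDyer.Rank1Residual.X11b.WeilTransport
import HarnessLib

/-!
# KIND (vii) — "TWO LAGRANGIAN LINES": at a place `v ∤ p` where two `p`-congruent curves both have
# ONE rational line of `p`-torsion and no unramified Kummer class, their local Kummer conditions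
# COINCIDE (cell `b2b-bsdres`, team n1011, row T-2LL, FILE 2; seat p04 GEN 11;
# skeleton `cells/n1011/skel/T-2LL.md`; referee-1 GEN 36 ACK-1 provisos (i)–(vii))

HONEST FRAMING (cell `b2b-bsdres`, run/shared/lean/b2b/bsd-rank1-residual/, verbatim in every
file): the goal of the cell is to DELETE the COMBINATION-SHAPED residual classes of the
Birch–Swinnerton-Dyer formula for ALL analytic-rank `≤ 1` elliptic curves over `ℚ` — "full BSD
formula for every rank `≤ 1` curve in class `C`" assembled STRICTLY from published theorems — so
that the rank-`≤ 1` remainder becomes exactly the CONSTRUCTION-SHAPED classes, which are TYPED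
(missing-input `Prop`s), NOT attempted. This is not "finishing BSD". Team n1011 (N10 / N11, the
additive block X4 ∧ `p = 3`): research route on the CONSTRUCTION-SHAPED class X4; no claim beyond
the stated classes; nothing is booked; no mark / label / count is changed by this file. Theorems
only (no definition, no named fact, no `sorry`); NO named-fact hypothesis (the inputs are the
tree's PROVED local Euler characteristic in the prime-to-residue-characteristic case, the PROVED
local Tate duality for `E[n]`, the DISCHARGED Poonen–Rains isotropy, and the cell's T-E3g-ADD
theorems). Closes NO class by itself: it frees one more kind of place in a per-row visibility
certificate whose other inputs are EVIDENCE until kernel-certified.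

## What

Kinds (i)–(vi), (iii′) of the tree's refined visibility certificate compare the local Selmer
conditions `𝓢_v(E)`, `θ_* 𝓢_v(E′)` of `p`-congruent curves (`θ : E′[p] ⥲ E[p]`) at places of good
or (potentially) multiplicative reduction. KIND (vii) serves the places `v ∤ p` where BOTH curves
are ADDITIVE with a `K_v`-rational point of order `p` (`p = 3`: Kodaira IV / IV* with `c_v = 3` on
both sides) — route planner 1's FAIL-other class "add-pg/add-pg (v = 2)" of ROUTE-1 §41.3 and its
`v = 5, 7, 11, …` siblings, §44's L44 case `r = r′ = 1`. It is stated in THEOREM-SHAPED generality: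

**`map_kummerLocalConditionAt_eq_of_inertia_torsion`** — `p` an odd prime, `v ∤ p`,
`#E(K_v)[p] = p` (`hcard`), and the INERTIA-TORSION hypotheses `hI`, `hI′`: every point of
`E[p^∞](K̄)`, resp. `E′[p^∞](K̄)`, fixed by the inertia group of `K_v` is killed by `p` — in the
exact currency of the cell's `Additive.UnramifiedKummerDisjoint` (p06, T-E3g-ADD FILE A), DISCHARGED
at every ADDITIVE `v ∤ p`, `p` odd, by `Additive.inertia_torsion_of_hasAdditiveReductionAt`
(T-E3g-ADD FILE B; Kodaira–Néron over `K_v^nr`). THEN for every continuous `Γ_{K_v}`-intertwining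
`f : E′[p]| → E[p]|` acting as `θ`:

  `(𝓛_v(E′)).map H¹(f) = 𝓛_v(E)`  (`𝓛_v = kummerLocalConditionAt`, the image of `E(K_v)/p`).

Consequences: `h1Equiv_mem_selmerLocalKer_of_inertia_torsion` (`θ_* 𝓢_v(E′) ≤ 𝓢_v(E)`),
`relIndex_map_selmerLocalKer_eq_one_of_inertia_torsion` (`ι_v(θ) = 1`), and the transport
`natCard_ker_nsmul_eq_of_congr` (`#E(K_v)[p] = #E′(K_v)[p]`, so that a record may display the
partner's count; referee-1 proviso (i)).

## Proof ("a hyperbolic plane has exactly two isotropic lines")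

With `H = H¹(K_v, E[p])` and the local Weil cup product `b = · ∪ₑ ·` (any Weil pairing `e`,
`exists_weilPairing_holds`):
* §1 `#H = (#E(K_v)[p])² = p²` (`natCard_galoisCohomology_one_torsion_eq_sq_of_not_mem`): Tate's
  local Euler–Poincaré characteristic is a TREE THEOREM for modules of order prime to the residue
  characteristic (`natCard_invariants_mul_natCard_two_eq`), with `#H⁰ = #H² = #E(K_v)[p]`
  (`natCard_invariants_torsion_restrictField`, `natCard_galoisCohomology_two_torsion_restrictField`);
* §2 `b` is SYMMETRIC (`weilCupProduct_comm`: graded commutativity `ContPairing.cupProduct_comm` and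
  `e` alternating, `weilPairingHom_add_swap_eq_zero`); it is non-degenerate
  (`eq_zero_of_forall_weilCupProduct_eq_zero`) and `H` is killed by `p`;
* `𝓛 = 𝓛_v(E)` has order `p` (`natCard_kummerLocalConditionAt_adicCompletion`, `#(𝓞_v/p) = 1`) and is
  its own annihilator (`forall_mem_kummerLocalConditionAt_weilCupProduct_eq_zero_iff`, Poonen–Rains +
  the count);
* §3 `M = H¹(f)(𝓛_v(E′))` has order `p` (`NonsplitKummer.natCard_kummerLocalConditionAt_eq_of_congr`,
  `NonsplitKummer.map_injective_of_leftInverse`) and is ISOTROPIC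
  (`cupProduct_map_map_eq_zero_of_mem_kummerLocalConditionAt`: Poonen–Rains for `E′` and the pulled
  back pairing `e ∘ (θ × θ)`, transported at the cocycle level);
* the unramified subgroup `U = H¹_ur(K_v, E[p])` meets `𝓛` trivially and contains some `u ∉ 𝓛`
  (p06's `Additive.exists_mem_unramifiedSubgroup_not_mem_kummerLocalConditionAt_of_inertia_torsion_of_point`,
  from `hI` and a non-zero point of `E(K_v)[p]`), `u ∉ M` likewise (`hI′`, naturality
  `X11b.Levels.map_mem_unramifiedSubgroup`), and `b(u, u) = 0` (FILE 1,
  `cupProduct_restrict_eq_zero_of_mem_unramifiedSubgroup`: unramified classes are isotropic);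
* §4 the finite-group lemma `LagrangianDichotomy.eq_of_isotropic_lines_of_isotropic_not_mem` (FILE 2a)
  concludes `M = 𝓛`.

No hypothesis on the reduction type, on `c_v`, on Kodaira symbols or on a witness point enters;
`(p : 𝓞 K) ∉ v.asIdeal` and `hcard` are BINDERS (referee-1 provisos (iv), (v)).

## References

* [MilneADT2006] J. S. Milne, *Arithmetic Duality Theorems*, 2nd ed. (2006), Ch. I: Cor. 2.3,
  Prop. 2.6, Thm. 2.8, Lemma 2.9, Cor. 3.4, Lemma 3.3, Prop. 3.8.
* [PoonenRains2012] B. Poonen, E. Rains, *Random maximal isotropic subspaces and Selmer groups*,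
  JAMS 25 (2012), Prop. 4.8, Cor. 4.6, Prop. 4.10–4.11.
* [MazurRubin2004] B. Mazur, K. Rubin, *Kolyvagin systems*, Mem. AMS 799 (2004), §2.3 (comparison
  of Selmer structures); B. Mazur, K. Rubin, *Selmer companion curves*, Trans. AMS 367 (2015),
  Thm. 3.1 (iv), Lemma 20 — they compare at additive potentially good places through
  `E[p²] ≅ E′[p²]`; the present statement uses `E[p]` alone when `dim E[p]^{G_v} = 1`.
* [CremonaMazur2000] J. E. Cremona, B. Mazur, Experiment. Math. 9 (2000), §3.
* cells/n1011/ROUTE-1.md §41.3, §44 (planner r1: L44, ST-44a).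

## Design

`noncomputable section`; §§1–3 universe-polymorphic (`K : Type u`), §4 at universe `0` (`K : Type`,
as the cell's comparison files and the x11a certificate, whose Tate facts are consumed at `.{0}`);
cup products carry `[LocallyCompactSpace Γ_{K_v}]` as an instance BINDER in §§2–3 and obtain it in
§4 from the tree's `absoluteGaloisGroup_compactSpace` (no local instance attribute). Axioms:
`propext`, `Classical.choice`, `Quot.sound`.
-/

noncomputable section

open scoped Classical ContRepresentation
open CategoryTheory Function
open Field NumberField IsDedekindDomain WeierstrassCurve IsNonarchimedeanLocalField ValuativeRel
open Literature.NumberTheory.EllipticCurves Literature.NumberTheory.GaloisRepresentations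

universe u

namespace Summit.BirchSwinnertonDyer.Rank1Residual.GaloisImage

namespace TwoLagrangianLines

open _root_.TopRep _root_.ContRepresentation _root_.ContinuousCohomology

/-! ## §4 KIND (vii): the local Kummer conditions coincide along `θ` -/

section Local

-- universe `0` for `K`: the cell's comparison files (`NonsplitKummer.map_injective_of_leftInverse`, the
-- x11a certificate) are stated there (the Tate facts are consumed at `.{0}`).
variable {K : Type} [Field K] [NumberField K] (W W' : WeierstrassCurve K) [W.IsElliptic]
  [W'.IsElliptic] (v : HeightOneSpectrum (𝓞 K)) {p : ℕ} [hp : Fact p.Prime]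

omit [NumberField K] [W.IsElliptic] [W'.IsElliptic] hp in
/-- `H¹(g) ∘ H¹(f) = id` on `H¹(Γ_E, E′[p](K̄)|_{Γ_E})` when `g ∘ f = id` (cocycle level). [folklore] -/
theorem map_map_eq_self_of_leftInverse {E : Type} [Field E] [Algebra K E]
    (f : (GaloisRep.restrictField E (W'.torsionGaloisModule (p : ℤ))).toContRepresentation →ⁱL
      (GaloisRep.restrictField E (W.torsionGaloisModule (p : ℤ))).toContRepresentation)
    (g : (GaloisRep.restrictField E (W.torsionGaloisModule (p : ℤ))).toContRepresentation →ⁱL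
      (GaloisRep.restrictField E (W'.torsionGaloisModule (p : ℤ))).toContRepresentation)
    (hgf : ∀ x, g (f x) = x)
    (c : galoisCohomology (GaloisRep.restrictField E (W'.torsionGaloisModule (p : ℤ))) 1) :
    galoisCohomology.map g 1 (galoisCohomology.map f 1 c) = c := by
  obtain ⟨ξ, rfl⟩ := oneCocycleClass_surjective _ c
  rw [galoisCohomology.map_one_oneCocycleClass, galoisCohomology.map_one_oneCocycleClass]
  exact congrArg (oneCocycleClass _) (Subtype.ext (ContinuousMap.ext fun σ ↦ hgf (ξ.1 σ)))

/-- **KIND (vii), local form — "two Lagrangian lines".** Let `p` be an odd prime, `v ∤ p` a finite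
place of the number field `K`, `E = W`, `E′ = W′` elliptic curves with a `Γ_K`-isomorphism
`θ : E′[p] ≃ E[p]`, and `f` a continuous `Γ_{K_v}`-intertwining map of the restricted torsion
modules acting as `θ`. Assume (`hcard`) `#E(K_v)[p] = p` and (`hI`, `hI′`) that every point of
`E[p^∞](K̄)`, resp. `E′[p^∞](K̄)`, fixed by the inertia group of `K_v` is killed by `p` (the
inertia-torsion hypothesis of `Additive.UnramifiedKummerDisjoint`; TRUE at every additive `v ∤ p`,
`Additive.inertia_torsion_of_hasAdditiveReductionAt`). Then the local Kummer conditions correspond: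
`(𝓛_v(E′)).map H¹(f) = 𝓛_v(E)`. Proof: in `H = H¹(K_v, E[p])`, of order `p²` (§1) and killed by
`p`, with the symmetric (§2) non-degenerate Weil cup product, `𝓛 = 𝓛_v(E)` is a self-annihilating
subgroup of order `p` (`forall_mem_kummerLocalConditionAt_weilCupProduct_eq_zero_iff`),
`M = H¹(f)(𝓛_v(E′))` is isotropic of order `p` (§3, `NonsplitKummer.natCard_kummerLocalConditionAt_eq_of_congr`,
`NonsplitKummer.map_injective_of_leftInverse`), and an unramified class `u` with `u ∉ 𝓛`
(`Additive.exists_mem_unramifiedSubgroup_not_mem_kummerLocalConditionAt_of_inertia_torsion_of_point`),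
`u ∉ M` (`Additive.unramifiedSubgroup_inf_kummerLocalConditionAt_eq_bot_of_inertia_torsion` for `E′`,
`X11b.Levels.map_mem_unramifiedSubgroup`) and `u ∪ u = 0` (FILE 1) exists; conclude by
`LagrangianDichotomy.eq_of_isotropic_lines_of_isotropic_not_mem`. No reduction type, Tamagawa number,
Kodaira symbol or witness point enters. [cite: MilneADT2006, Ch. I, Cor. 3.4 and Prop. 3.8]
[cite: PoonenRains2012, Prop. 4.10 and Prop. 4.11] [cite: MazurRubin2004, §2.3] -/
theorem map_kummerLocalConditionAt_eq_of_inertia_torsion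
    (hpv : (p : 𝓞 K) ∉ v.asIdeal) (hp2 : p ≠ 2)
    (θ : geomTorsion W' (p : ℤ) ≃+ geomTorsion W (p : ℤ))
    (hθ : ∀ (σ : absoluteGaloisGroup K) (P : geomTorsion W' (p : ℤ)), θ (σ • P) = σ • θ P)
    (hcard : Nat.card (nsmulAddMonoidHom p :
      (W.baseChange (v.adicCompletion K)).toAffine.Point →+ _).ker = p)
    (hI : ∀ Q : W.geomPrimaryTorsion p,
      (∀ τ ∈ absInertia (v.adicCompletion K),
        GaloisRep.restrictField (v.adicCompletion K) (X11b.LocBridge.primaryGaloisModule W p) τ Q = Q) →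
      p • Q = 0)
    (hI' : ∀ Q : W'.geomPrimaryTorsion p,
      (∀ τ ∈ absInertia (v.adicCompletion K),
        GaloisRep.restrictField (v.adicCompletion K) (X11b.LocBridge.primaryGaloisModule W' p) τ Q = Q) →
      p • Q = 0)
    (f : (GaloisRep.restrictField (v.adicCompletion K)
        (W'.torsionGaloisModule (p : ℤ))).toContRepresentation →ⁱL
      (GaloisRep.restrictField (v.adicCompletion K)
        (W.torsionGaloisModule (p : ℤ))).toContRepresentation)
    (hf : ∀ x, f x = θ x) :
    (W'.kummerLocalConditionAt (p : ℤ) (v.adicCompletion K)).map (galoisCohomology.map f 1) =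
      W.kummerLocalConditionAt (p : ℤ) (v.adicCompletion K) := by
  have hpp : p.Prime := hp.out
  have hp0 : p ≠ 0 := hpp.ne_zero
  have hn : ((p : ℕ) : ℤ) ≠ 0 := by exact_mod_cast hp0
  haveI : NeZero p := ⟨hp0⟩
  haveI : CharZero (v.adicCompletion K) := charZero_adicCompletion v
  haveI : PerfectField K := PerfectField.ofCharZero
  haveI : Finite (geomTorsion W (p : ℤ)) := finite_geomTorsion_of_neZero W p
  haveI : CompactSpace (absoluteGaloisGroup (v.adicCompletion K)) :=
    absoluteGaloisGroup_compactSpace (v.adicCompletion K)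
  haveI : Finite (DiscreteGaloisModule.MuCarrier K p) := finite_muCarrier p K
  -- the inverse intertwining map
  have hθ' : ∀ (σ : absoluteGaloisGroup K) (P : geomTorsion W (p : ℤ)),
      θ.symm (σ • P) = σ • θ.symm P := fun σ P ↦ by
    apply θ.injective
    rw [AddEquiv.apply_symm_apply, hθ, AddEquiv.apply_symm_apply]
  let gθ : (W.torsionGaloisModule (p : ℤ)).toContRepresentation →ⁱL
      (W'.torsionGaloisModule (p : ℤ)).toContRepresentation :=
    { toContinuousLinearMap := ⟨θ.symm.toAddMonoidHom.toIntLinearMap,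
        continuous_of_discreteTopology⟩
      isIntertwining' := fun σ ↦ ContinuousLinearMap.ext fun P ↦ hθ' σ P }
  set g := gθ.restrictField (v.adicCompletion K) with hg
  have hgf : ∀ x, g (f x) = x := fun x ↦ by
    change θ.symm (f x) = x
    rw [hf, AddEquiv.symm_apply_apply]
  have hinj : Function.Injective (galoisCohomology.map f 1) :=
    NonsplitKummer.map_injective_of_leftInverse W' W f g hgf
  -- a Weil pairing on `E[p]` and the local Weil cup product `b`
  obtain ⟨e, hμ, hadd₁, hadd₂, halt, hnondeg, hgal⟩ :=
    exists_weilPairing_holds W p hpp.two_le (by exact_mod_cast hp0)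
  set P := (weilContPairing W p e hμ hadd₁ hadd₂ hgal).restrict (absGaloisRestrict K (v.adicCompletion K)) with hP
  set H := galoisCohomology (GaloisRep.restrictField (v.adicCompletion K) (W.torsionGaloisModule (p : ℤ))) 1 with hH
  let b : H →+ H →+ galoisCohomology (GaloisRep.restrictField (v.adicCompletion K) (DiscreteGaloisModule.mu K p)) 2 :=
    AddMonoidHom.mk' (fun x ↦ (P.cupProduct x).toAddMonoidHom) fun x x' ↦
      AddMonoidHom.ext fun y ↦ DFunLike.congr_fun (map_add P.cupProduct x x') y
  have hb : ∀ x y, b x y = P.cupProduct x y := fun _ _ ↦ rfl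
  -- the three subgroups
  set L := W.kummerLocalConditionAt (p : ℤ) (v.adicCompletion K) with hL
  set L' := W'.kummerLocalConditionAt (p : ℤ) (v.adicCompletion K) with hL'
  set M := L'.map (galoisCohomology.map f 1) with hM
  -- counts
  have hHcard : Nat.card H = p ^ 2 := by
    rw [hH, natCard_galoisCohomology_one_torsion_eq_sq_of_not_mem W v hpv, hcard]
  have hLcard : Nat.card L = p := by
    rw [hL, W.natCard_kummerLocalConditionAt_adicCompletion v hp0, hcard,
      natCard_quot_adicCompletionIntegers_eq_one hpv, mul_one]
  have hL'card : Nat.card L' = p := by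
    rw [hL', ← NonsplitKummer.natCard_kummerLocalConditionAt_eq_of_congr W W' v θ hθ]; exact hLcard
  have hMcard : Nat.card M = p :=
    (Nat.card_congr (L'.equivMapOfInjective _ hinj).toEquiv).symm.trans hL'card
  have hHp : ∀ x : H, p • x = 0 :=
    nsmul_continuousCohomology_one_eq_zero _ p (fun T : geomTorsion W (p : ℤ) ↦
      AddSubgroup.torsionBy.nsmul T)
  -- symmetry, isotropy, maximality
  have hsymm : ∀ x y, b x y = b y x := fun x y ↦ by
    rw [hb, hb]; exact weilCupProduct_comm W p e hμ hadd₁ hadd₂ (v.adicCompletion K) hgal halt x y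
  have hLL : ∀ x ∈ L, ∀ y ∈ L, b x y = 0 := fun x hx y hy ↦
    W.cupProduct_eq_zero_of_mem_kummerLocalConditionAt_of_fact p e hn
      (kummerClass_cupProduct_kummerClass_eq_zero_holds (v.adicCompletion K)) hμ hadd₁ hadd₂ halt hgal hx hy
  have hMM : ∀ x ∈ M, ∀ y ∈ M, b x y = 0 := by
    rintro _ ⟨x', hx', rfl⟩ _ ⟨y', hy', rfl⟩
    exact cupProduct_map_map_eq_zero_of_mem_kummerLocalConditionAt W W' v e hμ hadd₁ hadd₂ θ hθ
      hgal halt f hf hx' hy'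
  have hLmax : ∀ x, (∀ y ∈ L, b x y = 0) → x ∈ L := fun x hx ↦
    (forall_mem_kummerLocalConditionAt_weilCupProduct_eq_zero_iff W p e hμ hadd₁ hadd₂ (v.adicCompletion K) hgal halt
      hnondeg (by change Nat.card H ≤ Nat.card L * Nat.card L; rw [hHcard, hLcard, sq]) x).mp hx
  -- the unramified witness `u ∉ L`, `u ∉ M`, `u ∪ u = 0`
  haveI : Finite (nsmulAddMonoidHom p : (W.baseChange (v.adicCompletion K)).toAffine.Point →+ _).ker :=
    W.finite_ker_nsmul_adicCompletion v hp0
  obtain ⟨T, hT0⟩ : ∃ T : (nsmulAddMonoidHom p : (W.baseChange (v.adicCompletion K)).toAffine.Point →+ _).ker, T ≠ 0 := by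
    haveI : Nontrivial (nsmulAddMonoidHom p : (W.baseChange (v.adicCompletion K)).toAffine.Point →+ _).ker :=
      Finite.one_lt_card_iff_nontrivial.mp (by rw [hcard]; exact hpp.one_lt)
    exact exists_ne 0
  have hT0' : (T : (W.baseChange (v.adicCompletion K)).toAffine.Point) ≠ 0 := fun h ↦ hT0 (Subtype.ext h)
  have hpT : (p : ℤ) • (T : (W.baseChange (v.adicCompletion K)).toAffine.Point) = 0 := by
    rw [natCast_zsmul]; exact (AddMonoidHom.mem_ker).mp T.2
  obtain ⟨u, huU, huL⟩ :=
    Additive.exists_mem_unramifiedSubgroup_not_mem_kummerLocalConditionAt_of_inertia_torsion_of_point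
      W p v hpv hI hT0' hpT
  have hu : b u u = 0 :=
    cupProduct_restrict_eq_zero_of_mem_unramifiedSubgroup (v.adicCompletion K) (weilContPairing W p e hμ hadd₁ hadd₂ hgal)
      huU huU
  have huM : u ∉ M := by
    rintro ⟨x', hx', hux⟩
    have hx'U : x' ∈ DiscreteGaloisModule.unramifiedSubgroup
        (GaloisRep.restrictField (v.adicCompletion K) (W'.torsionGaloisModule (p : ℤ))) 1 := by
      rw [← map_map_eq_self_of_leftInverse W W' f g hgf x', hux]
      exact X11b.Levels.map_mem_unramifiedSubgroup g huU
    have hbot := Additive.unramifiedSubgroup_inf_kummerLocalConditionAt_eq_bot_of_inertia_torsion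
      W' p v hpv hI'
    have hx'0 : x' = 0 := by
      have hmem : x' ∈ DiscreteGaloisModule.unramifiedSubgroup
          (GaloisRep.restrictField (v.adicCompletion K) (W'.torsionGaloisModule (p : ℤ))) 1 ⊓ L' := ⟨hx'U, hx'⟩
      rw [hL', hbot] at hmem
      exact (AddSubgroup.mem_bot).mp hmem
    apply huL
    rw [← hux, hx'0, map_zero]
    exact zero_mem _
  exact LagrangianDichotomy.eq_of_isotropic_lines_of_isotropic_not_mem hpp hp2 b hsymm hHp hHcard
    L M hLcard hMcard hLL hMM hLmax hu huL huM


/-- **`#E(K_v)[p] = #E′(K_v)[p]` for `p`-congruent curves** (so a record may certify KIND (vii)'s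
`hcard` on either side; referee-1 proviso (i)): both are `#𝓛_v / #(𝓞_v/p)`
(`natCard_kummerLocalConditionAt_adicCompletion`) and `#𝓛_v(E) = #𝓛_v(E′)`
(`NonsplitKummer.natCard_kummerLocalConditionAt_eq_of_congr`, Galois descent along `θ`).
[cite: MilneADT2006, Ch. I, Lemma 3.3] -/
theorem natCard_ker_nsmul_eq_of_congr (θ : geomTorsion W' (p : ℤ) ≃+ geomTorsion W (p : ℤ))
    (hθ : ∀ (σ : absoluteGaloisGroup K) (P : geomTorsion W' (p : ℤ)), θ (σ • P) = σ • θ P) :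
    Nat.card (nsmulAddMonoidHom p : (W.baseChange (v.adicCompletion K)).toAffine.Point →+ _).ker =
      Nat.card (nsmulAddMonoidHom p :
        (W'.baseChange (v.adicCompletion K)).toAffine.Point →+ _).ker := by
  have hp0 : p ≠ 0 := hp.out.ne_zero
  haveI : CharZero (v.adicCompletion K) := charZero_adicCompletion v
  have h := NonsplitKummer.natCard_kummerLocalConditionAt_eq_of_congr W W' v θ hθ
  rw [W.natCard_kummerLocalConditionAt_adicCompletion v hp0,
    W'.natCard_kummerLocalConditionAt_adicCompletion v hp0] at h
  exact Nat.eq_of_mul_eq_mul_right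
    (Nat.pos_of_ne_zero (LocalPoints.card_quotient_span_natCast_ne_zero v hp0)) h

/-- **KIND (vii): `θ_* 𝓢_v(E′) ≤ 𝓢_v(E)`** at a finite place `v ∤ p` (`p` odd) with
`#E(K_v)[p] = p` and the inertia-torsion hypotheses `hI`, `hI′` (true at every ADDITIVE `v ∤ p`):
the local Selmer conditions of `p`-congruent curves agree along `θ : E′[p] ≃ E[p]`. From the local
form with `f = θ|_{Γ_{K_v}}`: `res_v (θ_* c) = H¹(θ|)(res_v c)` (`galoisCohomology.res_map_one`) and
`𝓢_v = res_v⁻¹ 𝓛_v` (`comap_res_kummerLocalConditionAt`). The companion of kinds (iv′)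
(`NonsplitKummer.h1Equiv_mem_selmerLocalKer_of_nonsplit_of_hasGoodReductionAt`) and (vi)
(`…_of_hasGoodReductionAt_of_nonsplit`); here NO Tate uniformisation is used.
[cite: CremonaMazur2000, §3] [cite: MilneADT2006, Ch. I, Cor. 3.4 and Prop. 3.8] -/
theorem h1Equiv_mem_selmerLocalKer_of_inertia_torsion
    (hpv : (p : 𝓞 K) ∉ v.asIdeal) (hp2 : p ≠ 2)
    (θ : geomTorsion W' (p : ℤ) ≃+ geomTorsion W (p : ℤ))
    (hθ : ∀ (σ : absoluteGaloisGroup K) (P : geomTorsion W' (p : ℤ)), θ (σ • P) = σ • θ P)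
    (hcard : Nat.card (nsmulAddMonoidHom p :
      (W.baseChange (v.adicCompletion K)).toAffine.Point →+ _).ker = p)
    (hI : ∀ Q : W.geomPrimaryTorsion p,
      (∀ τ ∈ absInertia (v.adicCompletion K),
        GaloisRep.restrictField (v.adicCompletion K) (X11b.LocBridge.primaryGaloisModule W p) τ Q = Q) →
      p • Q = 0)
    (hI' : ∀ Q : W'.geomPrimaryTorsion p,
      (∀ τ ∈ absInertia (v.adicCompletion K),
        GaloisRep.restrictField (v.adicCompletion K) (X11b.LocBridge.primaryGaloisModule W' p) τ Q = Q) →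
      p • Q = 0)
    {c : galH1Torsion W' (p : ℤ)} (hc : c ∈ selmerLocalKer W' (v.adicCompletion K) (p : ℤ)) :
    h1Equiv θ hθ c ∈ selmerLocalKer W (v.adicCompletion K) (p : ℤ) := by
  -- `θ` as an intertwining map and its restriction to `Γ_{K_v}`
  let fθ : (W'.torsionGaloisModule (p : ℤ)).toContRepresentation →ⁱL
      (W.torsionGaloisModule (p : ℤ)).toContRepresentation :=
    { toContinuousLinearMap := ⟨θ.toAddMonoidHom.toIntLinearMap, continuous_of_discreteTopology⟩
      isIntertwining' := fun σ ↦ ContinuousLinearMap.ext fun P ↦ hθ σ P }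
  set f := fθ.restrictField (v.adicCompletion K) with hfdef
  have hf : ∀ x, f x = θ x := fun _ ↦ rfl
  have key := map_kummerLocalConditionAt_eq_of_inertia_torsion W W' v hpv hp2 θ hθ hcard hI hI' f hf
  -- `res_v c ∈ 𝓛_v(E′)`, hence `H¹(f)(res_v c) ∈ 𝓛_v(E)`
  have hres : galoisCohomology.res (W'.torsionGaloisModule (p : ℤ)) (v.adicCompletion K) 1 c ∈
      W'.kummerLocalConditionAt (p : ℤ) (v.adicCompletion K) := by
    rw [← comap_res_kummerLocalConditionAt] at hc
    exact hc
  have hmem : galoisCohomology.map f 1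
      (galoisCohomology.res (W'.torsionGaloisModule (p : ℤ)) (v.adicCompletion K) 1 c) ∈
      W.kummerLocalConditionAt (p : ℤ) (v.adicCompletion K) := by
    rw [← key]
    exact AddSubgroup.mem_map_of_mem _ hres
  -- `res_v (θ_* c) = H¹(f) (res_v c)`
  have hmapθ : galoisCohomology.map fθ 1 c = h1Equiv θ hθ c := by
    obtain ⟨φ, rfl⟩ :=
      oneCocycleClass_surjective (discreteTopRep (absoluteGaloisGroup K) (geomTorsion W' (p : ℤ))) c
    rw [h1Equiv_oneCocycleClass]
    exact (galoisCohomology.map_one_oneCocycleClass fθ φ).trans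
      (congrArg (oneCocycleClass _) (Subtype.ext (ContinuousMap.ext fun σ ↦ rfl)))
  have hgoal : galoisCohomology.res (W.torsionGaloisModule (p : ℤ)) (v.adicCompletion K) 1
      (h1Equiv θ hθ c) ∈ W.kummerLocalConditionAt (p : ℤ) (v.adicCompletion K) := by
    rw [← hmapθ, galoisCohomology.res_map_one, ← hfdef]
    exact hmem
  have key' : h1Equiv θ hθ c ∈ (W.kummerLocalConditionAt (p : ℤ) (v.adicCompletion K)).comap
      (galoisCohomology.res (W.torsionGaloisModule (p : ℤ)) (v.adicCompletion K) 1) := hgoal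
  rwa [comap_res_kummerLocalConditionAt] at key'

/-- **`ι_v(θ) = 1` at a kind-(vii) place** (`v ∤ p`, `p` odd, `#E(K_v)[p] = p`, inertia-torsion on
both sides): the comparison index of `CongruenceVisibilityComparison.lean` is `1`.
[cite: CremonaMazur2000, §3] [cite: MazurRubin2004, §2.3] -/
theorem relIndex_map_selmerLocalKer_eq_one_of_inertia_torsion
    (hpv : (p : 𝓞 K) ∉ v.asIdeal) (hp2 : p ≠ 2)
    (θ : geomTorsion W' (p : ℤ) ≃+ geomTorsion W (p : ℤ))
    (hθ : ∀ (σ : absoluteGaloisGroup K) (P : geomTorsion W' (p : ℤ)), θ (σ • P) = σ • θ P)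
    (hcard : Nat.card (nsmulAddMonoidHom p :
      (W.baseChange (v.adicCompletion K)).toAffine.Point →+ _).ker = p)
    (hI : ∀ Q : W.geomPrimaryTorsion p,
      (∀ τ ∈ absInertia (v.adicCompletion K),
        GaloisRep.restrictField (v.adicCompletion K) (X11b.LocBridge.primaryGaloisModule W p) τ Q = Q) →
      p • Q = 0)
    (hI' : ∀ Q : W'.geomPrimaryTorsion p,
      (∀ τ ∈ absInertia (v.adicCompletion K),
        GaloisRep.restrictField (v.adicCompletion K) (X11b.LocBridge.primaryGaloisModule W' p) τ Q = Q) →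
      p • Q = 0) :
    (selmerLocalKer W (v.adicCompletion K) (p : ℤ)).relIndex
        ((selmerLocalKer W' (v.adicCompletion K) (p : ℤ)).map (h1Equiv θ hθ).toAddMonoidHom) = 1 :=
  (relIndex_map_selmerLocalKer_eq_one_iff W W' θ hθ).mpr fun _ hc ↦
    h1Equiv_mem_selmerLocalKer_of_inertia_torsion W W' v hpv hp2 θ hθ hcard hI hI' hc

end Local

end TwoLagrangianLines

end Summit.BirchSwinnertonDyer.Rank1Residual.GaloisImage

end
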